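import Summits.QuantumFields.YangMills.Theorems.AlphaInputsT3ACv3AdaptedClass
import HarnessLib

/-!
# `AlphaInputsT3ACv3AdaptedSel` — STRATEGY B for 2′ (design note `STRATEGY-B-adapted-class-T3-alpha1-g5.md` §B.2–B.3): the MEASURABLE ARGMIN SELECTOR
# of the Wilson action over the adapted class `𝒞(k, h, W)` (`AlphaInputsT3ACv3AdaptedClass`), minimisers by compactness, and MEMBERSHIP ⇒ THE ROWS'
# TEXTS (`h68`, `hLF67` of `AlphaV3AC.RunAlphaV3AC`; r2, r3 of `MinimiserRowsT3`) — lane `pub-balaban3d`, seat alpha-2 (g0)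

CONTENTS.  §1 ★ `AlphaInputsT3AC.exists_selector_adaptedClassT3` (`k ≤ K`, any history): a measurable `f : SU(2)^{bonds_k} → SU(2)^{bonds_0}` with
`f W ∈ argmin_{𝒞(k,h,W)} A` wherever a minimiser exists (`1` elsewhere), and a minimiser EXISTS whenever `𝒞(k,h,W) ≠ ∅` — the sibling's closed-class selection
with `C` = the W-independent core, `g Ũ = ((blockAvg ℰp)^k Ũ, Ũ)`, `π W = (W, 1)`, and the closed relation «`W` charged ⇒ (42)-top on the bonds of `Ω_k(h)` ∧ r3»
(the window is open).  §2 membership ⇒ rows: `h68_of_regLift` (NODE O's `h68_of_reg2` for a BARE configuration, via `B8Ineq132.pdevOn_lt_of_forall`),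
`h68_of_mem_adaptedClassT3`, `hLF67_of_mem_adaptedClassT3`, `constraint42_of_mem_adaptedClassT3`, `regularity68Levels_of_mem_adaptedClassT3`.

HONEST FRAMING.  Kinematics∕measurable selection only; nothing of [B10]∕[7]∕[4]'s estimates is asserted; the selected configuration is NOT claimed to be
print's (42)-minimiser (at `h ≠ triv` the adapted-class argmin is a different variational problem — part of the displayed gap of `DataSchemaT3AC`); the
class's non-emptiness is displayed elsewhere, not proved.  Count-neutral helper toward R3 2′ (items 19935∕19936); nothing about d = 4, the continuum, or a mass gap.

References: T. Bałaban, Commun. Math. Phys. 102 (1985) 255–275 [Balaban1985UV3] ((42) p.266, (67)–(68) p.273); CMP 102 (1985) 277–309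
[Balaban1985Variational] (Thm 1 (8) p.279); C. D. Aliprantis, K. C. Border, Infinite Dimensional Analysis (2006) Thm 18.19 [AliprantisBorder2006].
-/

set_option autoImplicit false

noncomputable section

namespace Summit.QuantumFields.YangMills.Theorems

open MeasureTheory Set Topology TopologicalSpace
open scoped Matrix Matrix.Norms.L2Operator
open Literature.MeasureTheory.RandomSets
open Literature.MathematicalPhysics.QuantumFieldTheory.Balaban1983to89
open Literature.MathematicalPhysics.QuantumFieldTheory.Balaban1983to89.B10 (pFun)
open Literature.MathematicalPhysics.QuantumFieldTheory.Balaban1983to89.T3ContinuumYM3Torus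
open Literature.MathematicalPhysics.QuantumFieldTheory.Balaban1983to89.T3UnitLawDensityEML (ℰp)
open Literature.MathematicalPhysics.QuantumFieldTheory.Balaban1983to89.T3UnitScaleTilt (θBal)
open Literature.MathematicalPhysics.QuantumFieldTheory.Balaban1983to89.B10Eq38TorusDomains (plaqsIn)
open Literature.MathematicalPhysics.QuantumFieldTheory.Balaban1983to89.B10Eq42TorusConstraint (bondsIn lam42)
open Literature.MathematicalPhysics.QuantumFieldTheory.Balaban1983to89.B10Eq70Squaring (deltaBox)
open Literature.MathematicalPhysics.QuantumFieldTheory.Balaban1985CMP102.Setting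
open Summit.QuantumFields.Balaban3D.Carriers
open Summit.QuantumFields.Balaban3D.Proofs.Primitives (AlphaConsts)
open Summit.QuantumFields.Balaban3D.Proofs.LiftBridge (liftCfg)
open Summit.QuantumFields.Balaban3D.Proofs.TorusLift (projSite zOf projSite_mem_plaqCover)
open Summit.QuantumFields.Balaban3D.Proofs.AdmissibleRegions (plaqCover_subset_of_admissible)
open Summit.QuantumFields.Balaban3D.Proofs.Run3SmallFactors (codeZ decode_of_mem_disc)
open Summit.QuantumFields.Balaban3D.Proofs.ScalesArithmetic (gk_pos gk_le_one)
open Summit.QuantumFields.Balaban3D.Proofs.CouplingWindow (pFun_pos)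
open Summit.QuantumFields.BalabanUV.T4Continuum.SubstrateBlockAvgContinuity (NestedSmall isClosed_nestedSmall continuousOn_iter_blockAvg
  nestedSmall_succ_subset smallContinuous_expMeanLogSU one_mem_nestedSmall_expMeanLogSU)
open Summit.QuantumFields.YangMills.Theorems.BalabanUVNodesN08AlphaGroupTopology
open Summit.QuantumFields.YangMills.Theorems.BalabanUVNodesN08AlphaLiftAvgCont (continuousAt_val_hol)
open Summit.QuantumFields.YangMills.Theorems.BalabanUVNodesN08AlphaArgClass
open Summit.QuantumFields.YangMills.Theorems.BalabanUVNodesN08AlphaRegSel (regClass)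
open Summit.QuantumFields.YangMills.Theorems.BalabanUVNodesN08AlphaCompactSel (regClassC isClosed_regClassC regClassC_subset_regClass one_mem_regClassC)
open Summit.QuantumFields.YangMills.Theorems.BalabanUVNodesN08AlphaClassI (RegLift)
open Summit.QuantumFields.YangMills.Theorems.BalabanUVNodesN08AlphaClassIDischarge (mem_deltaBox_of_inBox)
open B7Prop1Explicit (hol plaqWord)
open B7Prop1Local (pdevOn loK plaqHiK InBox hol_plaqWord_eq)
open B7Prop2Explicit (avgIter hol_plaqWord_self)
open B8Ineq132 (pdevOn_lt_of_forall)

/-! ## §1 The measurable argmin selector of the adapted class -/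

section T3

variable {F : T3Family} {𝔠 : AlphaConsts F.L (suGroupModel 2).N} {γ : ℝ} {hγ : 0 < γ} {hγ1 : γ ≤ (min 𝔠.gamma0 1) ^ 2} {K : ℕ}

open Classical in
/-- **★ MINIMISERS AND A MEASURABLE ARGMIN SELECTOR FOR THE ADAPTED CLASS** (`k ≤ K`, any history `h`): (i) a measurable
`f : SU(2)^{bonds_k} → SU(2)^{bonds_0}` with `f W ∈ argmin_{𝒞(k,h,W)} A` (Wilson action) wherever a minimiser exists and `f W = 1` elsewhere; (ii) a minimiser
EXISTS as soon as `𝒞(k, h, W) ≠ ∅`.  §1's closed-class selection with `C` = the W-independent core, `g Ũ = ((blockAvg ℰp)^k Ũ, Ũ)`, `π W = (W, 1)` and the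
closed relation «`W` charged ⇒ top constraint on the bonds of `Ω_k(h)` ∧ r3» (the window is open, `isOpen_chargedT3`).
[cite: Balaban1985Variational, Thm 1 (8) p.279 (existence half by compactness; measurable-selection reading)] -/
theorem AlphaInputsT3AC.exists_selector_adaptedClassT3 {k : ℕ} (hk : k ≤ K) (h : Hist (F.P K) k) :
    (∃ f : GaugeField (F.P K) k (Matrix.specialUnitaryGroup (Fin 2) ℂ) → GaugeField (F.P K) 0 (Matrix.specialUnitaryGroup (Fin 2) ℂ),
      Measurable f ∧
      (∀ W, (∃ U ∈ AlphaInputsT3AC.adaptedClassT3 F 𝔠 γ hγ hγ1 K k h W,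
          IsMinOn (fun U : GaugeField (F.P K) 0 (Matrix.specialUnitaryGroup (Fin 2) ℂ) => wilsonAction4 U)
            (AlphaInputsT3AC.adaptedClassT3 F 𝔠 γ hγ hγ1 K k h W) U) →
        f W ∈ AlphaInputsT3AC.adaptedClassT3 F 𝔠 γ hγ hγ1 K k h W ∧
          IsMinOn (fun U : GaugeField (F.P K) 0 (Matrix.specialUnitaryGroup (Fin 2) ℂ) => wilsonAction4 U)
            (AlphaInputsT3AC.adaptedClassT3 F 𝔠 γ hγ hγ1 K k h W) (f W)) ∧
      (∀ W, ¬ (∃ U ∈ AlphaInputsT3AC.adaptedClassT3 F 𝔠 γ hγ hγ1 K k h W,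
          IsMinOn (fun U : GaugeField (F.P K) 0 (Matrix.specialUnitaryGroup (Fin 2) ℂ) => wilsonAction4 U)
            (AlphaInputsT3AC.adaptedClassT3 F 𝔠 γ hγ hγ1 K k h W) U) → f W = 1)) ∧
    (∀ W, (AlphaInputsT3AC.adaptedClassT3 F 𝔠 γ hγ hγ1 K k h W).Nonempty →
      ∃ U ∈ AlphaInputsT3AC.adaptedClassT3 F 𝔠 γ hγ hγ1 K k h W,
        IsMinOn (fun U : GaugeField (F.P K) 0 (Matrix.specialUnitaryGroup (Fin 2) ℂ) => wilsonAction4 U)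
          (AlphaInputsT3AC.adaptedClassT3 F 𝔠 γ hγ hγ1 K k h W) U) := by
  haveI : CompactSpace (GaugeField (F.P K) 0 (Matrix.specialUnitaryGroup (Fin 2) ℂ)) :=
    inferInstanceAs (CompactSpace (PBond (F.P K) 0 → Matrix.specialUnitaryGroup (Fin 2) ℂ))
  haveI : PolishSpace (Matrix.specialUnitaryGroup (Fin 2) ℂ) := polishSpace_rho (suGroupModel 2)
  haveI : PolishSpace (GaugeField (F.P K) 0 (Matrix.specialUnitaryGroup (Fin 2) ℂ)) :=
    inferInstanceAs (PolishSpace (PBond (F.P K) 0 → Matrix.specialUnitaryGroup (Fin 2) ℂ))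
  haveI : SecondCountableTopology (GaugeField (F.P K) 0 (Matrix.specialUnitaryGroup (Fin 2) ℂ)) :=
    inferInstanceAs (SecondCountableTopology (PBond (F.P K) 0 → Matrix.specialUnitaryGroup (Fin 2) ℂ))
  haveI : BorelSpace (GaugeField (F.P K) 0 (Matrix.specialUnitaryGroup (Fin 2) ℂ)) :=
    inferInstanceAs (BorelSpace (PBond (F.P K) 0 → Matrix.specialUnitaryGroup (Fin 2) ℂ))
  haveI : SecondCountableTopology (GaugeField (F.P K) k (Matrix.specialUnitaryGroup (Fin 2) ℂ)) :=
    inferInstanceAs (SecondCountableTopology (PBond (F.P K) k → Matrix.specialUnitaryGroup (Fin 2) ℂ))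
  haveI : BorelSpace (GaugeField (F.P K) k (Matrix.specialUnitaryGroup (Fin 2) ℂ)) :=
    inferInstanceAs (BorelSpace (PBond (F.P K) k → Matrix.specialUnitaryGroup (Fin 2) ℂ))
  -- the data of §1's selection
  let C : Set (GaugeField (F.P K) 0 (Matrix.specialUnitaryGroup (Fin 2) ℂ)) :=
    NestedSmall (P := F.P K) ℰp (ℰp.δ / 2) k ∩
      (argClassC (S := T3Scales F γ hγ (hγ1.trans (sq_min_one_le _ 𝔠.gamma0_pos)) K) (suGroupModel 2) k ∩
        AlphaInputsT3AC.large67Set F 𝔠 γ hγ hγ1 K k h) ∩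
      regClassC (S := T3Scales F γ hγ (hγ1.trans (sq_min_one_le _ 𝔠.gamma0_pos)) K) (suGroupModel 2) 𝔠 k h
  have hC : IsClosed C := AlphaInputsT3AC.isClosed_adaptedCore (𝔠 := 𝔠) (hγ1 := hγ1) hk h
  let g : GaugeField (F.P K) 0 (Matrix.specialUnitaryGroup (Fin 2) ℂ) →
      GaugeField (F.P K) k (Matrix.specialUnitaryGroup (Fin 2) ℂ) × GaugeField (F.P K) 0 (Matrix.specialUnitaryGroup (Fin 2) ℂ) :=
    fun U => (Averaging.iter (fun i => BlockAveraging.blockAvg (P := F.P K) (j := i) ℰp) k U, U)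
  have hg : ContinuousOn g C :=
    ((AlphaInputsT3AC.continuousOn_iter_ℰp (F := F) (K := K) le_rfl).mono fun U hU => hU.1.1).prodMk continuousOn_id
  let π : GaugeField (F.P K) k (Matrix.specialUnitaryGroup (Fin 2) ℂ) →
      GaugeField (F.P K) k (Matrix.specialUnitaryGroup (Fin 2) ℂ) × GaugeField (F.P K) 0 (Matrix.specialUnitaryGroup (Fin 2) ℂ) :=
    fun W => (W, 1)
  have hπ : Measurable π := measurable_id.prodMk measurable_const
  let Sm : Set (GaugeField (F.P K) k (Matrix.specialUnitaryGroup (Fin 2) ℂ)) :=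
    {W | ChargedT3 F γ 𝔠.b₀ 𝔠.p₀ (avgWindowFactor F.L) K 𝔠.lane.carrier.M₁
      (rcolOf (T3Scales F γ hγ (hγ1.trans (sq_min_one_le _ 𝔠.gamma0_pos)) K) 𝔠.lane.carrier) k h W}
  let Bk : Set (PBond (F.P K) k) := bondsIn k (Omega 𝔠.lane.carrier.M₁
      (rcolOf (T3Scales F γ hγ (hγ1.trans (sq_min_one_le _ 𝔠.gamma0_pos)) K) 𝔠.lane.carrier) k h k)
  let D : Set (GaugeField (F.P K) 0 (Matrix.specialUnitaryGroup (Fin 2) ℂ)) :=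
    NestedSmall (P := F.P K) ℰp (ℰp.δ / 2) k ∩ AlphaInputsT3AC.reg68LevelsSet F 𝔠 γ hγ hγ1 K k h
  let R : Set ((GaugeField (F.P K) k (Matrix.specialUnitaryGroup (Fin 2) ℂ) × GaugeField (F.P K) 0 (Matrix.specialUnitaryGroup (Fin 2) ℂ)) ×
      (GaugeField (F.P K) k (Matrix.specialUnitaryGroup (Fin 2) ℂ) × GaugeField (F.P K) 0 (Matrix.specialUnitaryGroup (Fin 2) ℂ))) :=
    {p | p.2.1 ∈ Sm → (∀ b ∈ Bk, p.1.1 b = p.2.1 b) ∧ p.1.2 ∈ D}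
  have hcoordk : ∀ b : PBond (F.P K) k, Continuous fun V : GaugeField (F.P K) k (Matrix.specialUnitaryGroup (Fin 2) ℂ) => V b :=
    fun b => continuous_apply b
  have hR : IsClosed R := by
    have hset : R = {p | p.2.1 ∈ Sm}ᶜ ∪ ((⋂ b ∈ Bk, {p | p.1.1 b = p.2.1 b}) ∩ {p | p.1.2 ∈ D}) := by
      ext p
      simp only [R, mem_setOf_eq, mem_union, mem_compl_iff, mem_inter_iff, mem_iInter]
      by_cases hp : p.2.1 ∈ Sm
      · simp only [hp, forall_true_left, not_true_eq_false, false_or]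
      · simp only [hp, IsEmpty.forall_iff, not_false_eq_true, true_or]
    rw [hset]
    refine IsClosed.union ?_ (IsClosed.inter (isClosed_biInter fun b _ => ?_) ?_)
    · exact ((AlphaInputsT3AC.isOpen_chargedT3 (𝔠 := 𝔠) (hγ1 := hγ1) k h).preimage (continuous_fst.comp continuous_snd)).isClosed_compl
    · exact isClosed_eq ((hcoordk b).comp (continuous_fst.comp continuous_fst)) ((hcoordk b).comp (continuous_fst.comp continuous_snd))
    · exact (AlphaInputsT3AC.isClosed_nestedSmall_inter_reg68LevelsSet (𝔠 := 𝔠) (hγ1 := hγ1) k h).preimage (continuous_snd.comp continuous_fst)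
  -- the admissible sets of the selection ARE the adapted classes
  have hadm : ∀ W, {U | U ∈ C ∧ (g U, π W) ∈ R} = AlphaInputsT3AC.adaptedClassT3 F 𝔠 γ hγ hγ1 K k h W := by
    intro W
    ext U
    simp only [C, g, π, R, Sm, Bk, D, AlphaInputsT3AC.adaptedClassT3, AlphaInputsT3AC.top42Set, mem_setOf_eq, mem_inter_iff]
    constructor
    · rintro ⟨⟨⟨hN, hA, hL⟩, hReg⟩, hrel⟩
      exact ⟨hN, hA, hReg, hL, fun hc => ⟨(hrel hc).1, (hrel hc).2.2⟩⟩
    · rintro ⟨hN, hA, hReg, hL, hrel⟩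
      exact ⟨⟨⟨hN, hA, hL⟩, hReg⟩, fun hc => ⟨(hrel hc).1, hN, (hrel hc).2⟩⟩
  obtain ⟨⟨f, hfm, hfin, hfout⟩, hex⟩ := exists_measurable_argmin_closedClass hπ hC hg hR AlphaInputsT3AC.continuous_wilsonAction4_su2 1
  simp only [hadm] at hfin hfout hex
  exact ⟨⟨f, hfm, hfin, hfout⟩, hex⟩

/-! ## §2 Membership ⇒ the rows' texts -/

/-- **(68) ON `Δ′_j(p′)` FROM THE SCALE-`j` REGULARITY OF A CONFIGURATION** — NODE O's `h68_of_reg2` for a BARE configuration `U` (no external-inputs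
record): if the lift of `U` is `C68·g_jp(g_j)·L^{−2j}`-regular on every `Ω_j(h)`, `j < k`, then at every recorded large-field plaquette of the admissible
history `h` the deviation `pdevOn` over the box `Δ′` is `< C68·g_jp(g_j)·L^{−2j}` (every unit plaquette of the box has its lower-left corner covered by `p′`,
hence in `Λ_j(h) ⊂ Ω_j(h)`; `B8Ineq132.pdevOn_lt_of_forall`). [cite: Balaban1985UV3, (68) p.273] -/
theorem AlphaInputsT3AC.h68_of_regLift {L : ℕ} {S : Scales L} {G : Type} [GaugeGroup G] [MeasurableSpace G] {𝔊 : GroupModel G}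
    {𝔠 : AlphaConsts L 𝔊.N} {k : ℕ} (hk : k ≤ S.K) {h : Hist S.P k}
    (hh : Hist.Admissible 𝔠.lane.carrier.M₁ (rcolOf S 𝔠.lane.carrier) k h) (U : GaugeField S.P 0 G)
    (hreg : ∀ j < k, RegLift S j (Omega 𝔠.lane.carrier.M₁ (rcolOf S 𝔠.lane.carrier) k h j)
      (𝔠.C68 * (S.gk j * pFun 𝔠.lane.carrier.b₀ 𝔠.lane.carrier.p₀ (S.gk j))) (liftCfg 𝔊 U)) :
    ∀ e ∈ Hist.disc h,
      pdevOn (loK L e.1 (codeZ e)) (plaqHiK L e.1 (codeZ e) e.2.2.1 e.2.2.2) (liftCfg 𝔊 U) <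
        𝔠.C68 * (S.gk e.1 * pFun 𝔠.lane.carrier.b₀ 𝔠.lane.carrier.p₀ (S.gk e.1)) * (((L : ℝ) ^ e.1)⁻¹) ^ 2 := by
  intro q hq
  obtain ⟨j, hj, p, hp, hqj, hz, hμ, hν⟩ := decode_of_mem_disc hq
  have hq1 : q.1 = j := by rw [hqj]
  rw [hq1, hz, hμ, hν]
  have hjm : j ≤ S.P.m + S.P.K := by show j ≤ S.m + S.K; omega
  have hgj : 0 < S.gk j := gk_pos S j
  have hLr : (0 : ℝ) < L := by exact_mod_cast lt_trans zero_lt_one S.hL.2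
  have hc : 0 < 𝔠.C68 * (S.gk j * pFun 𝔠.lane.carrier.b₀ 𝔠.lane.carrier.p₀ (S.gk j)) * (((L : ℝ) ^ j)⁻¹) ^ 2 :=
    mul_pos (mul_pos 𝔠.C68_pos (mul_pos hgj (pFun_pos _ _ _ 𝔠.lane.F.b₀_pos hgj (gk_le_one S S.gK_le_one j (by omega)))))
      (pow_pos (inv_pos.mpr (pow_pos hLr j)) 2)
  refine pdevOn_lt_of_forall hc fun x μ ν hx _ => ?_
  rcases eq_or_ne μ ν with rfl | hμν
  · rw [hol_plaqWord_self, Units.val_one, sub_self, norm_zero]; exact hc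
  refine hreg j hj x μ ν hμν (Or.inl ?_)
  have hbox : x ∈ deltaBox (S.P.L ^ j) ((S.P.L ^ j) • zOf p) p.μ p.ν := mem_deltaBox_of_inBox S.P.L j (zOf p) p.μ p.ν hx
  exact (plaqCover_subset_of_admissible 𝔠.lane.carrier.M₁ (rcolOf S 𝔠.lane.carrier) hh hj hp
    (projSite_mem_plaqCover hjm p hbox)).1

/-- **MEMBERSHIP ⇒ ROW `h68`**: a member of the adapted class `𝒞(k, h, W)`, `k ≤ K`, `h` admissible, satisfies the v3 row `h68`'s text (through NODE O's
`regClassC ⊆ regClass` and `h68_of_regLift`). [cite: Balaban1985UV3, (68) p.273] -/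
theorem AlphaInputsT3AC.h68_of_mem_adaptedClassT3 {k : ℕ} (hk : k ≤ K) {h : Hist (F.P K) k}
    (hh : Hist.Admissible 𝔠.lane.carrier.M₁ (rcolOf (T3Scales F γ hγ (hγ1.trans (sq_min_one_le _ 𝔠.gamma0_pos)) K) 𝔠.lane.carrier) k h)
    {W : GaugeField (F.P K) k (Matrix.specialUnitaryGroup (Fin 2) ℂ)} {U : GaugeField (F.P K) 0 (Matrix.specialUnitaryGroup (Fin 2) ℂ)}
    (hU : U ∈ AlphaInputsT3AC.adaptedClassT3 F 𝔠 γ hγ hγ1 K k h W) :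
    ∀ e ∈ Hist.disc h,
      pdevOn (loK F.L e.1 (codeZ e)) (plaqHiK F.L e.1 (codeZ e) e.2.2.1 e.2.2.2)
          (liftCfg (S := T3Scales F γ hγ (hγ1.trans (sq_min_one_le _ 𝔠.gamma0_pos)) K) (suGroupModel 2) U) <
        𝔠.C68 * ((T3Scales F γ hγ (hγ1.trans (sq_min_one_le _ 𝔠.gamma0_pos)) K).gk e.1 *
          pFun 𝔠.lane.carrier.b₀ 𝔠.lane.carrier.p₀ ((T3Scales F γ hγ (hγ1.trans (sq_min_one_le _ 𝔠.gamma0_pos)) K).gk e.1)) *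
          (((F.L : ℝ) ^ e.1)⁻¹) ^ 2 :=
  AlphaInputsT3AC.h68_of_regLift (S := T3Scales F γ hγ (hγ1.trans (sq_min_one_le _ 𝔠.gamma0_pos)) K) hk hh U
    (regClassC_subset_regClass (S := T3Scales F γ hγ (hγ1.trans (sq_min_one_le _ 𝔠.gamma0_pos)) K) (suGroupModel 2) 𝔠 hk h hU.2.2.1)

/-- **MEMBERSHIP ⇒ ROW `hLF67`**: a member of `𝒞(k, h, W)` satisfies the v3 row `hLF67`'s text (it is the (67)-largeness conjunct). [cite: Balaban1985UV3, (67) p.273] -/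
theorem AlphaInputsT3AC.hLF67_of_mem_adaptedClassT3 {k : ℕ} {h : Hist (F.P K) k}
    {W : GaugeField (F.P K) k (Matrix.specialUnitaryGroup (Fin 2) ℂ)} {U : GaugeField (F.P K) 0 (Matrix.specialUnitaryGroup (Fin 2) ℂ)}
    (hU : U ∈ AlphaInputsT3AC.adaptedClassT3 F 𝔠 γ hγ hγ1 K k h W) :
    ∀ e ∈ Hist.disc h,
      (T3Scales F γ hγ (hγ1.trans (sq_min_one_le _ 𝔠.gamma0_pos)) K).gk e.1 *
          pFun 𝔠.lane.carrier.b₀ 𝔠.lane.carrier.p₀ ((T3Scales F γ hγ (hγ1.trans (sq_min_one_le _ 𝔠.gamma0_pos)) K).gk e.1) ≤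
        ‖((hol (avgIter F.L (liftCfg (S := T3Scales F γ hγ (hγ1.trans (sq_min_one_le _ 𝔠.gamma0_pos)) K) (suGroupModel 2) U) e.1)
            (codeZ e) (plaqWord e.2.2.1 e.2.2.2) : (Matrix (Fin (suGroupModel 2).N) (Fin (suGroupModel 2).N) ℂ)ˣ) :
            Matrix (Fin (suGroupModel 2).N) (Fin (suGroupModel 2).N) ℂ) - 1‖ :=
  hU.2.2.2.1

/-- **MEMBERSHIP ⇒ ROW r2** for a charged datum: the top constraint (42) on the bonds of `Ω_k(h)`. [cite: Balaban1985UV3, (42) p.266] -/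
theorem AlphaInputsT3AC.constraint42_of_mem_adaptedClassT3 {k : ℕ} {h : Hist (F.P K) k}
    {W : GaugeField (F.P K) k (Matrix.specialUnitaryGroup (Fin 2) ℂ)} {U : GaugeField (F.P K) 0 (Matrix.specialUnitaryGroup (Fin 2) ℂ)}
    (hU : U ∈ AlphaInputsT3AC.adaptedClassT3 F 𝔠 γ hγ hγ1 K k h W)
    (hc : ChargedT3 F γ 𝔠.b₀ 𝔠.p₀ (avgWindowFactor F.L) K 𝔠.lane.carrier.M₁
      (rcolOf (T3Scales F γ hγ (hγ1.trans (sq_min_one_le _ 𝔠.gamma0_pos)) K) 𝔠.lane.carrier) k h W)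
    (b : PBond (F.P K) k)
    (hb : b ∈ bondsIn k (Omega 𝔠.lane.carrier.M₁
      (rcolOf (T3Scales F γ hγ (hγ1.trans (sq_min_one_le _ 𝔠.gamma0_pos)) K) 𝔠.lane.carrier) k h k)) :
    Averaging.iter (fun i => BlockAveraging.blockAvg (P := F.P K) (j := i) ℰp) k U b = W b :=
  (hU.2.2.2.2 hc).1 b hb

/-- **MEMBERSHIP ⇒ ROW r3** for a charged datum: the multi-level regularity (68). [cite: Balaban1985UV3, (68) p.273] -/
theorem AlphaInputsT3AC.regularity68Levels_of_mem_adaptedClassT3 {k : ℕ} {h : Hist (F.P K) k}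
    {W : GaugeField (F.P K) k (Matrix.specialUnitaryGroup (Fin 2) ℂ)} {U : GaugeField (F.P K) 0 (Matrix.specialUnitaryGroup (Fin 2) ℂ)}
    (hU : U ∈ AlphaInputsT3AC.adaptedClassT3 F 𝔠 γ hγ hγ1 K k h W)
    (hc : ChargedT3 F γ 𝔠.b₀ 𝔠.p₀ (avgWindowFactor F.L) K 𝔠.lane.carrier.M₁
      (rcolOf (T3Scales F γ hγ (hγ1.trans (sq_min_one_le _ 𝔠.gamma0_pos)) K) 𝔠.lane.carrier) k h W)
    (i : ℕ) (hi : i ≤ k) (s : ℕ) (hs : s ≤ i) (q : Plaq (F.P K) s)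
    (hq : q ∈ plaqsIn s (lam42 (Omega 𝔠.lane.carrier.M₁
      (rcolOf (T3Scales F γ hγ (hγ1.trans (sq_min_one_le _ 𝔠.gamma0_pos)) K) 𝔠.lane.carrier) k h) k i)) :
    GaugeGroup.dist1 (GaugeField.plaqHol
        (Averaging.iter (fun l => BlockAveraging.blockAvg (P := F.P K) (j := l) ℰp) s U) q) ≤
      𝔠.C68 * θBal F.L γ 𝔠.b₀ 𝔠.p₀ (K - i) * (((F.L : ℝ) ^ (i - s))⁻¹) ^ 2 :=
  (hU.2.2.2.2 hc).2 i hi s hs q hq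

end T3

end Summit.QuantumFields.YangMills.Theorems

end
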